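import Literature.NumberTheory.LFunctions.RiemannXiHadamardProduct
import HarnessLib

/-!
# `|ξ(s)| ≤ |ξ(s+ε)|` on `Re s ≥ 1/2` under RH, and the master inequality for `ζ(s)/ζ(s+ε)`

Topic `Literature/NumberTheory/LFunctions`; a brick of the proof of Balazard–de Roton 2010,
Théorème 1 (`Literature.NumberTheory.LFunctions.BalazardDeRoton2010_thm1`, file
`NymanBeurlingRate.lean`), namely the Hadamard-product part of their §3 ("Étude du quotient
`ζ(s)/ζ(s+ε)`", Proposition 4): M. Balazard, A. de Roton, Int. J. Number Theory 6 (2010) 883–903 =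
arXiv:0812.1689, eqs. (t7), (t13) and the inequality
`|∏_ρ (s−ρ)/(s+ε−ρ)| < 1 (σ ≥ 1/2)` displayed before (t15).

* `norm_riemannXi_le_norm_riemannXi_add_of_RH` — under RH, for `Re s ≥ 1/2` and `ε ≥ 0`,
  `‖ξ(s)‖ ≤ ‖ξ(s+ε)‖`. Printed argument: `ξ(s) = ∏_ρ (1 − s/ρ)` and `|s−ρ| ≤ |s+ε−ρ|` for
  `σ ≥ β = Re ρ`; here with the tree's grouped Hadamard product
  `ξ(s)/ξ(½) = ∏ₙ (1 − bₙ(2s−1)²) = ∏ₙ (−4bₙ)(s−ρₙ)(s−(1−ρₙ))`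
  (`IsHadamardSeq.hasProd_riemannXi`, `factor_eq_mul`, PROVED in `RiemannXiHadamardProduct.lean`)
  and `Re ρₙ = Re (1−ρₙ) = 1/2` (RH), comparing the partial products termwise.
* `norm_zeta_mul_le_of_RH` — the resulting product-form master inequality (B.–de R. (t7) with the
  zero factor bounded by `1`): for `Re s ≥ 1/2`, `s ≠ 1`, `ε ≥ 0`,
  `‖ζ(s)‖ ‖s(s−1)‖ ‖Γℝ(s)‖ ≤ ‖ζ(s+ε)‖ ‖(s+ε)(s+ε−1)‖ ‖Γℝ(s+ε)‖`
  (`Γℝ(s) = π^{-s/2}Γ(s/2)`, Mathlib `Complex.Gammaℝ`; `ξ(s) = ½s(s−1)Γℝ(s)ζ(s)`).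

The remaining factors of (t7) — `(s+ε)(s+ε−1)/(s(s−1))` and the `Γ`-quotient (Stirling, (t10)) —
and Proposition 4 (i)–(iii) proper are treated in the sequel file; nothing here is specific to
`σ = 1/2`.

## References

* [BalazardDeRoton2010] M. Balazard, A. de Roton, Int. J. Number Theory 6 (2010) 883–903, §3,
  (t7) and Prop. 4 (arXiv:0812.1689 pp. 3–4).
* [Titchmarsh1986] E. C. Titchmarsh, *The Theory of the Riemann Zeta-Function*, 2nd ed., §2.12
  (Hadamard product of `ξ`).
-/

noncomputable section

open Complex Filter Topology

namespace Literature.NumberTheory.LFunctions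

namespace BalazardDeRoton

/-! ## Moving right, away from the critical line, increases the distance to every zero -/

/-- For `Re ρ ≤ Re s` and `ε ≥ 0`: `‖s − ρ‖ ≤ ‖s + ε − ρ‖`. [folklore] -/
lemma norm_sub_le_norm_add_sub {s ρ : ℂ} (h : ρ.re ≤ s.re) {ε : ℝ} (hε : 0 ≤ ε) :
    ‖s - ρ‖ ≤ ‖s + ε - ρ‖ := by
  have h2 : ‖s - ρ‖ ^ 2 ≤ ‖s + ε - ρ‖ ^ 2 := by
    rw [Complex.sq_norm, Complex.sq_norm, Complex.normSq_apply, Complex.normSq_apply]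
    simp only [sub_re, add_re, ofReal_re, sub_im, add_im, ofReal_im, add_zero]
    nlinarith
  exact (pow_le_pow_iff_left₀ (norm_nonneg _) (norm_nonneg _) two_ne_zero).mp h2

/-- Under RH every zero `ρₙ` of the grouped Hadamard product of `ξ` (`bₙ ≠ 0`) has `Re ρₙ = 1/2`.
[folklore] -/
lemma re_xiZero_eq_of_RH (hRH : RiemannHypothesis) {b : ℕ → ℂ} (hb : IsHadamardSeq 0 b) {n : ℕ}
    (hn : b n ≠ 0) : (IsHadamardSeq.xiZero b n).re = 1 / 2 := by
  obtain ⟨hz, h0, h1⟩ := hb.riemannZeta_xiZero hn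
  refine hRH _ hz ?_ ?_
  · rintro ⟨m, hm⟩
    have := congrArg Complex.re hm
    simp at this
    have hm0 : (0 : ℝ) ≤ m := Nat.cast_nonneg m
    linarith
  · intro h
    rw [h, one_re] at h1
    exact lt_irrefl _ h1

/-- **Termwise comparison.** Under RH, for `Re s ≥ 1/2` and `ε ≥ 0`, each grouped Hadamard factor
satisfies `‖1 − bₙ(2s−1)²‖ ≤ ‖1 − bₙ(2(s+ε)−1)²‖` (both sides equal
`4‖bₙ‖ ‖s−ρₙ‖ ‖s−(1−ρₙ)‖` resp. with `s+ε`, and `Re ρₙ = Re(1−ρₙ) = 1/2 ≤ Re s`).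
[cite: BalazardDeRoton2010, §3, before (t15)] -/
lemma norm_factor_le_of_RH (hRH : RiemannHypothesis) {b : ℕ → ℂ} (hb : IsHadamardSeq 0 b)
    {s : ℂ} (hs : 1 / 2 ≤ s.re) {ε : ℝ} (hε : 0 ≤ ε) (n : ℕ) :
    ‖1 - b n * (2 * s - 1) ^ 2‖ ≤ ‖1 - b n * (2 * (s + ε) - 1) ^ 2‖ := by
  by_cases hn : b n = 0
  · simp [hn]
  have hre := re_xiZero_eq_of_RH hRH hb hn
  rw [IsHadamardSeq.factor_eq_mul b hn, IsHadamardSeq.factor_eq_mul b hn]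
  simp only [norm_mul, norm_neg]
  have h1 : ‖s - IsHadamardSeq.xiZero b n‖ ≤ ‖s + ε - IsHadamardSeq.xiZero b n‖ :=
    norm_sub_le_norm_add_sub (by rw [hre]; exact hs) hε
  have h2 : ‖s - (1 - IsHadamardSeq.xiZero b n)‖ ≤ ‖s + ε - (1 - IsHadamardSeq.xiZero b n)‖ :=
    norm_sub_le_norm_add_sub (by rw [sub_re, one_re, hre]; linarith) hε
  gcongr

/-- **`|ξ(s)| ≤ |ξ(s+ε)|` on `Re s ≥ 1/2` under RH** (`ε ≥ 0`): the modulus of `ξ` is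
non-decreasing along horizontal rays leaving the closed right half of the critical strip. This is
Balazard–de Roton's `|∏_ρ (s−ρ)/(s+ε−ρ)| < 1 (σ ≥ 1/2)` (§3, before (t15)) in product-free form,
from the Hadamard product `ξ(s)/ξ(½) = ∏ₙ (1 − bₙ(2s−1)²)` compared termwise
(`norm_factor_le_of_RH`) at the level of partial products.
[cite: BalazardDeRoton2010, §3 (t7)–(t15)] -/
theorem norm_riemannXi_le_norm_riemannXi_add_of_RH (hRH : RiemannHypothesis) {s : ℂ}
    (hs : 1 / 2 ≤ s.re) {ε : ℝ} (hε : 0 ≤ ε) :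
    ‖riemannXi s‖ ≤ ‖riemannXi (s + ε)‖ := by
  obtain ⟨b, hb⟩ := exists_isHadamardSeq 0
  have h1 := ((continuous_norm.tendsto _).comp (hb.hasProd_riemannXi s))
  have h2 := ((continuous_norm.tendsto _).comp (hb.hasProd_riemannXi (s + ε)))
  have hle : ‖riemannXi s / riemannXi (1 / 2)‖ ≤ ‖riemannXi (s + ε) / riemannXi (1 / 2)‖ := by
    refine le_of_tendsto_of_tendsto' h1 h2 fun F ↦ ?_
    simp only [Function.comp_apply, norm_prod]
    exact Finset.prod_le_prod (fun n _ ↦ norm_nonneg _)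
      (fun n _ ↦ norm_factor_le_of_RH hRH hb hs hε n)
  have h0 : 0 < ‖riemannXi (1 / 2)‖ := norm_pos_iff.mpr riemannXi_one_half_ne_zero
  rwa [norm_div, norm_div, div_le_div_iff_of_pos_right h0] at hle

/-! ## The master inequality for `ζ(s)/ζ(s+ε)` -/

/-- `ξ(s) = ½ s(s−1) Γℝ(s) ζ(s)` in norm, off `s = 1`, for `Re s > 0`:
`‖ξ(s)‖ = ½ ‖s(s−1)‖ ‖Γℝ(s)‖ ‖ζ(s)‖`. [cite: Titchmarsh1986, §2.1 (2.1.12)] -/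
lemma norm_riemannXi_eq {s : ℂ} (hs0 : 0 < s.re) (hs1 : s ≠ 1) :
    ‖riemannXi s‖ = ‖s * (s - 1)‖ * ‖Gammaℝ s‖ * ‖riemannZeta s‖ / 2 := by
  have hs : s ≠ 0 := fun h ↦ by rw [h, zero_re] at hs0; exact lt_irrefl _ hs0
  have hG : Gammaℝ s ≠ 0 := Gammaℝ_ne_zero_of_re_pos hs0
  rw [riemannXi_eq_mul_completedRiemannZeta hs hs1, riemannZeta_def_of_ne_zero hs, norm_mul,
    norm_div, norm_div, Complex.norm_ofNat]
  field_simp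

/-- **Master inequality** (Balazard–de Roton (t7) with `|∏_ρ (s−ρ)/(s+ε−ρ)| ≤ 1`, product form):
under RH, for `Re s ≥ 1/2`, `s ≠ 1`, `s + ε ≠ 1`, `ε ≥ 0`,
`‖ζ(s)‖ ‖s(s−1)‖ ‖Γℝ(s)‖ ≤ ‖ζ(s+ε)‖ ‖(s+ε)(s+ε−1)‖ ‖Γℝ(s+ε)‖`.
[cite: BalazardDeRoton2010, §3 (t7)] -/
theorem norm_zeta_mul_le_of_RH (hRH : RiemannHypothesis) {s : ℂ} (hs : 1 / 2 ≤ s.re)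
    (hs1 : s ≠ 1) {ε : ℝ} (hε : 0 ≤ ε) (hs1' : s + ε ≠ 1) :
    ‖riemannZeta s‖ * ‖s * (s - 1)‖ * ‖Gammaℝ s‖ ≤
      ‖riemannZeta (s + ε)‖ * ‖(s + ε) * (s + ε - 1)‖ * ‖Gammaℝ (s + ε)‖ := by
  have h := norm_riemannXi_le_norm_riemannXi_add_of_RH hRH hs hε
  rw [norm_riemannXi_eq (by linarith) hs1,
    norm_riemannXi_eq (by simp; linarith) hs1'] at h
  have e1 : ‖riemannZeta s‖ * ‖s * (s - 1)‖ * ‖Gammaℝ s‖ =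
      2 * (‖s * (s - 1)‖ * ‖Gammaℝ s‖ * ‖riemannZeta s‖ / 2) := by ring
  have e2 : ‖riemannZeta (s + ε)‖ * ‖(s + ε) * (s + ε - 1)‖ * ‖Gammaℝ (s + ε)‖ =
      2 * (‖(s + ε) * (s + ε - 1)‖ * ‖Gammaℝ (s + ε)‖ * ‖riemannZeta (s + ε)‖ / 2) := by ring
  rw [e1, e2]
  exact mul_le_mul_of_nonneg_left h zero_le_two

end BalazardDeRoton

end Literature.NumberTheory.LFunctions

end
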